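import Literature.AlgebraicGeometry.Resolution.SncStrata
import Literature.AlgebraicGeometry.Resolution.BlowupsFlatBaseChange
import Literature.AlgebraicGeometry.Resolution.BlowupsExistence
import HarnessLib

/-!
# De Jong 1996, 2.4, the blowing-up step: reduction to strict normal crossings pairs

Topic: `Literature/AlgebraicGeometry/Resolution`. Second layer of the decomposition of the named
fact `DeJong1996NormalCrossingsBlowupStep` (`NormalCrossingsStrictification.lean`; de Jong 1996,
2.4, p. 55: one round of "blow up the points where `D` has three branches, then blow up the
strict transform of the curves where `D` has two branches, etc.", phrased with a marked strict
part `F ⊆ Z` and the bound `branchOrder Z ≤ branchOrder F + (m + 1)`). The source prints no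
proof; this file PROVES the reduction of the step for a NORMAL crossings divisor `Z` on a
Noetherian `S` to one statement about STRICT normal crossings pairs `F ⊆ Z` on locally
Noetherian schemes, vendored here as a named fact and discharged in sibling files. The centre of
the round is the top stratum `topStratum S Z F m = {s ∈ Z | branchOrder Z s = branchOrder F s
+ (m + 1)}` of `SncStrata.lean` (the points with the maximal number `m + 1` of branches of `Z`
that are not branches of `F`; closed for a strict pair with the bound, `isClosed_topStratum`).

* `preimage_topStratum_of_etale` — the top stratum is compatible with étale morphisms
  (`branchOrder_preimage_of_etale`).
* `SNCBlowupTopStratum` — NAMED FACT [folklore]: for a strict normal crossings pair with the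
  bound and ANY blowing up `φ : S₁ → S` of the (reduced) top stratum `C`: `φ⁻¹Z` is a strict
  normal crossings divisor, every point of `φ⁻¹Z` lies on at most `m` branches that are not
  branches of `φ⁻¹(F ∪ C)`, and — the form needed for étale descent — at every
  `s₁ ∈ φ⁻¹(F ∪ C)` the ideal of `φ⁻¹(F ∪ C)` is generated by the product of the EXPLICIT part
  of a regular system of parameters `(g, φ^* x₁, …, φ^* x_n)`, `g` any local equation of the
  exceptional divisor `φ⁻¹C` (dropped where it is a unit) and `x` any regular parameters with
  `I(F)_{φ s₁} = (x₁ ⋯ x_n)` (the chart computation for the blowing up of a regular local ring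
  along part of a regular system of parameters).
* PROVED: `IsRsopPart.of_etaleLocal_of_map_eq` — étale descent of such data: along a flat
  unramified essentially-finite-type local homomorphism `A → B` of Noetherian local rings, if the
  images of `t₁, …, t_n ∈ A` are part of a regular system of parameters of `B` and
  `I B = (t₁ ⋯ t_n) B`, then the `tᵢ` are part of one of `A` and `I = (t₁ ⋯ t_n)`.
* PROVED: `DeJong1996NormalCrossingsBlowupStep.of_sncBlowupTopStratum` — the named fact
  implies `DeJong1996NormalCrossingsBlowupStep`. Given `Z` normal crossings on `S` with étale
  surjective `e : S' → S` making `Z' = e⁻¹Z` strict, `F' = e⁻¹F` is strict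
  (`IsStrictNormalCrossingsDivisor.preimage_of_etale`), the bound and the top stratum pull back
  (`branchOrder_preimage_of_etale`), so `C = topStratum S Z F m` is closed (its preimage is,
  `isClosed_topStratum`, and `e` is open surjective). Blow up `S` in `I = I_C`
  (`exists_isBlowup`); the base change
  `φ' : S₁ ×_S S' → S'` is a blowing up of `I 𝒪_{S'} = I_{C'}` (`IsBlowup.pullback_snd_of_flat`,
  `comap_vanishingIdeal_of_etale`) to which `SNCBlowupTopStratum` applies, and
  `e₁ : S₁ ×_S S' → S₁` is étale surjective: so `φ⁻¹Z` is a normal crossings divisor, the bound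
  `m` descends (`branchOrder_preimage_of_etale`), and `φ⁻¹(F ∪ C)` is a STRICT normal crossings
  divisor on `S₁` because at `s₁` its ideal and the explicit parameters `(g, φ^* x)` are defined
  over `𝒪_{S₁,s₁}` and become the data of `SNCBlowupTopStratum` in `𝒪_{S₁ ×_S S', s₁'}`
  (`IsRsopPart.of_etaleLocal_of_map_eq`).

## Sources

* A. J. de Jong, *Smoothness, semi-stability and alterations*, Publ. Math. IHÉS 83 (1996) 51–93,
  2.4 (p. 55). [DeJong1996]
* The Stacks Project, Tags 0BI9, 0BIA (strict normal crossings), 0805 (blowing up commutes with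
  flat base change). [StacksProject]
* H. Matsumura, *Commutative Ring Theory* (1986), Thm. 23.7 (flat descent of regularity).
  [Matsumura1987]
-/

noncomputable section

open CategoryTheory CategoryTheory.Limits AlgebraicGeometry TopologicalSpace IsLocalRing

namespace Literature.AlgebraicGeometry.Resolution

open Scheme.IdealSheafData

universe u

/-! ## The top stratum along étale morphisms -/

section TopStratum

variable {S : Scheme.{u}} {Z F : Set S} {m : ℕ}

/-- **The top stratum is compatible with étale morphisms**: for `e : S' → S` étale (`S` locally
Noetherian) and `Z, F` closed, `e⁻¹(topStratum S Z F m) = topStratum S' (e⁻¹Z) (e⁻¹F) m`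
(branch orders are invariant, `branchOrder_preimage_of_etale`). [folklore] -/
theorem preimage_topStratum_of_etale {S' : Scheme.{u}} (e : S' ⟶ S) [Etale e]
    [IsLocallyNoetherian S] (hZ : IsClosed Z) (hF : IsClosed F) :
    e ⁻¹' topStratum S Z F m = topStratum S' (e ⁻¹' Z) (e ⁻¹' F) m := by
  ext s'
  simp only [Set.mem_preimage, mem_topStratum_iff, branchOrder_preimage_of_etale e hZ,
    branchOrder_preimage_of_etale e hF]

end TopStratum

/-! ## The named fact about strict normal crossings pairs -/

/-- NAMED FACT — **blowing up the top stratum of a strict normal crossings pair** [folklore; the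
chart computation behind de Jong 1996, 2.4]. Let `S` be locally Noetherian, `Z ⊆ S` a strict
normal crossings divisor, `F ⊆ Z` a strict normal crossings divisor, `m : ℕ` with
`branchOrder Z ≤ branchOrder F + (m + 1)` on `Z`, `C = topStratum S Z F m` (closed), and
`φ : S₁ → S` ANY blowing up of `S` in the ideal sheaf `I_C` of the reduced closed subscheme `C`
(`IsBlowup φ (vanishingIdeal C)`). Then:
(i) `φ⁻¹Z` is a strict normal crossings divisor on `S₁`;
(ii) for `s₁ ∈ φ⁻¹Z`, `branchOrder (φ⁻¹Z) s₁ ≤ branchOrder (φ⁻¹(F ∪ C)) s₁ + m`;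
(iii) for `s₁ ∈ φ⁻¹(F ∪ C)`, every generator `g` of the (invertible) ideal
`(I_C · 𝒪_{S₁})_{s₁}` of the exceptional divisor and every part `x₁, …, x_n` of a regular
system of parameters of `𝒪_{S, φ s₁}` with `I(F)_{φ s₁} = (x₁ ⋯ x_n)` (`n = 0` allowed): if `g`
is a unit, `(φ^* x₁, …, φ^* x_n)` is part of a regular system of parameters of `𝒪_{S₁,s₁}` and
`I(φ⁻¹(F ∪ C))_{s₁} = (∏ φ^* xᵢ)`; if not, the same holds for `(g, φ^* x₁, …, φ^* x_n)`.
(Proof, in sibling files: Zariski-locally at `s ∈ C`, `I(Z)_s = (w₁ ⋯ w_r)`,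
`I(F)_s = (w_{m+2} ⋯ w_r)`, `I(C)_s = (w₁, …, w_{m+1})`; after flat base change to
`Spec 𝒪_{S,s}` the blowing up is covered by the charts `𝒪_{S,s}[wᵢ/wⱼ : i ≤ m + 1]`, on which
`φ⁻¹Z = V(wⱼ · ∏_{i ≠ j} (wᵢ/wⱼ) · ∏_{k > m+1} w_k)` with all factors part of a regular system
of parameters at every point, `wⱼ` a local equation of `φ⁻¹C`.) Users take
`(h : SNCBlowupTopStratum)`. [cite: DeJong1996, 2.4, p. 55] -/
def SNCBlowupTopStratum : Prop :=
  ∀ (S : Scheme.{u}) [IsLocallyNoetherian S] (Z F : Set S) (m : ℕ),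
    IsStrictNormalCrossingsDivisor S Z → IsStrictNormalCrossingsDivisor S F → F ⊆ Z →
      (∀ s ∈ Z, branchOrder S Z s ≤ branchOrder S F s + (m + 1 : ℕ)) →
      ∀ (hC : IsClosed (topStratum S Z F m)) (S₁ : Scheme.{u}) (φ : S₁ ⟶ S),
        IsBlowup φ (vanishingIdeal ⟨topStratum S Z F m, hC⟩) →
          IsStrictNormalCrossingsDivisor S₁ (φ ⁻¹' Z) ∧
          (∀ s₁ ∈ φ ⁻¹' Z, branchOrder S₁ (φ ⁻¹' Z) s₁ ≤
              branchOrder S₁ (φ ⁻¹' (F ∪ topStratum S Z F m)) s₁ + m) ∧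
          ∀ s₁ ∈ φ ⁻¹' (F ∪ topStratum S Z F m), ∀ g : S₁.presheaf.stalk s₁,
            stalkIdeal ((vanishingIdeal ⟨topStratum S Z F m, hC⟩).comap φ) s₁ =
                Ideal.span {g} →
              ∀ (n : ℕ) (x : Fin n → S.presheaf.stalk (φ s₁)), IsRsopPart x →
                stalkIdeal (vanishingIdeal ⟨closure F, isClosed_closure⟩) (φ s₁) =
                    Ideal.span {∏ i, x i} →
                  (IsUnit g →
                    IsRsopPart ((φ.stalkMap s₁).hom ∘ x) ∧
                      stalkIdeal (vanishingIdeal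
                        ⟨closure (φ ⁻¹' (F ∪ topStratum S Z F m)), isClosed_closure⟩) s₁ =
                          Ideal.span {∏ i, (φ.stalkMap s₁).hom (x i)}) ∧
                  (¬ IsUnit g →
                    IsRsopPart (Fin.cons g ((φ.stalkMap s₁).hom ∘ x) : Fin (n + 1) → _) ∧
                      stalkIdeal (vanishingIdeal
                        ⟨closure (φ ⁻¹' (F ∪ topStratum S Z F m)), isClosed_closure⟩) s₁ =
                          Ideal.span {∏ i, (Fin.cons g ((φ.stalkMap s₁).hom ∘ x) :
                            Fin (n + 1) → _) i})

/-! ## Étale descent of regular parameters cutting out an ideal -/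

section Descent

variable {A B : Type u} [CommRing A] [CommRing B] [Algebra A B] [IsLocalRing A] [IsLocalRing B]
  [IsLocalHom (algebraMap A B)]

/-- **Étale descent of strict normal crossings data**: along a flat, unramified, essentially
finite-type local homomorphism `A → B` of Noetherian local rings, if the images of
`t₁, …, t_n ∈ A` are part of a regular system of parameters of `B` and `I B = (t₁ ⋯ t_n) B` for
an ideal `I ⊆ A`, then `t₁, …, t_n` are part of a regular system of parameters of `A`
(`isRsopPart_map_iff_of_etaleLocal`) and `I = (t₁ ⋯ t_n)` (faithful flatness: `J B ∩ A = J`).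
[cite: Matsumura1987, Thm. 23.7] -/
theorem IsRsopPart.of_etaleLocal_of_map_eq [IsNoetherianRing A] [IsNoetherianRing B]
    [Module.Flat A B] [Algebra.EssFiniteType A B] [Algebra.FormallyUnramified A B] {n : ℕ}
    (t : Fin n → A) (ht : IsRsopPart (algebraMap A B ∘ t)) (I : Ideal A)
    (hI : I.map (algebraMap A B) = Ideal.span {∏ i, algebraMap A B (t i)}) :
    IsRsopPart t ∧ I = Ideal.span {∏ i, t i} := by
  haveI : Module.FaithfullyFlat A B := Module.FaithfullyFlat.of_flat_of_isLocalHom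
  refine ⟨(isRsopPart_map_iff_of_etaleLocal (A := A) (B := B) t).mp ht, ?_⟩
  have h1 : (Ideal.span {∏ i, t i}).map (algebraMap A B) =
      Ideal.span {∏ i, algebraMap A B (t i)} := by
    rw [Ideal.map_span, Set.image_singleton, map_prod]
  rw [← Ideal.comap_map_eq_self_of_faithfullyFlat (B := B) I, hI, ← h1,
    Ideal.comap_map_eq_self_of_faithfullyFlat (B := B)]

end Descent

/-! ## Bookkeeping: empty parts, transport along isomorphisms and equal points -/

section Bookkeeping

/-- In a regular local ring the empty family is part of a regular system of parameters.
[folklore] -/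
theorem isRsopPart_of_isRegularLocalRing_zero {R : Type u} [CommRing R] [IsRegularLocalRing R]
    (z : Fin 0 → R) : IsRsopPart z := by
  obtain ⟨y, hy⟩ := exists_regularSystemOfParameters (R := R)
  refine ⟨inferInstance, (maximalIdeal R).spanFinrank, y, ?_, ?_⟩
  · rw [← IsRegularLocalRing.spanFinrank_maximalIdeal (R := R), Nat.zero_add]
  · rw [Set.range_eq_empty z, Set.empty_union, hy]

/-- Transport of a part of a regular system of parameters along a ring isomorphism.
[folklore] -/
theorem IsRsopPart.map_ringEquiv {R R' : Type u} [CommRing R] [CommRing R'] [IsLocalRing R]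
    [IsLocalRing R'] (ε : R ≃+* R') {n : ℕ} {z : Fin n → R} (hz : IsRsopPart z) :
    IsRsopPart (ε ∘ z) := by
  obtain ⟨hR, e, y, hdim, hspan⟩ := hz
  haveI := hR
  refine ⟨IsRegularLocalRing.of_ringEquiv ε, e, ε ∘ y, ?_, ?_⟩
  · rw [← hdim]
    exact (ringKrullDim_eq_of_ringEquiv ε).symm
  · have h1 : Set.range (⇑ε ∘ z) ∪ Set.range (⇑ε ∘ y) = ε '' (Set.range z ∪ Set.range y) := by
      rw [Set.image_union, Set.range_comp, Set.range_comp]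
    rw [h1, ← IsLocalRing.map_ringEquiv_maximalIdeal ε, ← hspan, Ideal.map_span]

variable {X : Scheme.{u}}

/-- The stalk isomorphism between equal points is the identity after `subst`. [folklore] -/
theorem stalkCongr_hom_of_eq_refl (p : X) :
    (X.presheaf.stalkCongr (Inseparable.of_eq (rfl : p = p))).hom = 𝟙 _ := by
  simp

/-- Parts of regular systems of parameters transported along the stalks of equal points.
[folklore] -/
theorem IsRsopPart.comp_stalkCongr {p q : X} (h : p = q) {n : ℕ} {z : Fin n → X.presheaf.stalk p}
    (hz : IsRsopPart z) :
    IsRsopPart ((X.presheaf.stalkCongr (Inseparable.of_eq h)).hom.hom ∘ z) :=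
  hz.map_ringEquiv (X.presheaf.stalkCongr (Inseparable.of_eq h)).commRingCatIsoToRingEquiv

/-- Stalks of an ideal sheaf at equal points correspond under the stalk isomorphism.
[folklore] -/
theorem map_stalkCongr_stalkIdeal (J : X.IdealSheafData) {p q : X} (h : p = q) :
    (stalkIdeal J p).map (X.presheaf.stalkCongr (Inseparable.of_eq h)).hom.hom =
      stalkIdeal J q := by
  subst h
  rw [stalkCongr_hom_of_eq_refl, CommRingCat.hom_id, Ideal.map_id]

end Bookkeeping

/-! ## Pointwise étale descent of the strict normal crossings condition -/

section Pointwise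

variable {S S' S₁ P : Scheme.{u}} (φ : S₁ ⟶ S) (e : S' ⟶ S) (e₁ : P ⟶ S₁) (φ' : P ⟶ S')

/-- **Pointwise descent of strict normal crossings data through a commutative square with étale
horizontal maps.** Let `e₁ ≫ φ = φ' ≫ e` with `e`, `e₁` étale (`S`, `S₁` locally Noetherian),
`F₁ ⊆ S₁` closed, `s₁' ∈ P`, `g₀ ∈ 𝒪_{S₁, e₁ s₁'}` and `x₀` a family in `𝒪_{S, φ(e₁ s₁')}`.
Suppose that upstairs — for `g = e₁^* g₀` and `x = e^* x₀` (read in `𝒪_{S', φ' s₁'}`) — the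
family `φ'^* x` (if `g` is a unit) resp. `(g, φ'^* x)` (if not) is part of a regular system of
parameters of `𝒪_{P, s₁'}` generating the ideal of `e₁⁻¹ F₁` at `s₁'`. Then the family
`φ^* x₀` resp. `(g₀, φ^* x₀)` is part of a regular system of parameters of `𝒪_{S₁, e₁ s₁'}`
whose product generates `I(F₁)_{e₁ s₁'}`: the data are defined over `𝒪_{S₁, e₁ s₁'}`, and
`𝒪_{S₁, e₁ s₁'} → 𝒪_{P, s₁'}` is étale local (`IsRsopPart.of_etaleLocal_of_map_eq`,
`comap_vanishingIdeal_of_etale`). [folklore] -/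
theorem isRsopPart_and_stalkIdeal_eq_of_etale_square [Etale e] [Etale e₁]
    [IsLocallyNoetherian S] [IsLocallyNoetherian S₁] (hsq : e₁ ≫ φ = φ' ≫ e)
    {F₁ : Set S₁} (hF₁ : IsClosed F₁) {F₁' : Set P} (hF₁' : e₁ ⁻¹' F₁ = F₁') (s₁' : P)
    (g₀ : S₁.presheaf.stalk (e₁ s₁')) {n : ℕ}
    (x₀ : Fin n → S.presheaf.stalk (φ (e₁ s₁')))
    (H : let g := (e₁.stalkMap s₁').hom g₀
      let x : Fin n → S'.presheaf.stalk (φ' s₁') := (e.stalkMap (φ' s₁')).hom ∘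
        (S.presheaf.stalkCongr (Inseparable.of_eq
          (show φ (e₁ s₁') = e (φ' s₁') by
            rw [← Scheme.Hom.comp_apply, hsq, Scheme.Hom.comp_apply]))).hom.hom ∘ x₀
      (IsUnit g →
        IsRsopPart ((φ'.stalkMap s₁').hom ∘ x) ∧
          stalkIdeal (vanishingIdeal ⟨closure F₁', isClosed_closure⟩) s₁' =
            Ideal.span {∏ i, (φ'.stalkMap s₁').hom (x i)}) ∧
      (¬ IsUnit g →
        IsRsopPart (Fin.cons g ((φ'.stalkMap s₁').hom ∘ x) : Fin (n + 1) → _) ∧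
          stalkIdeal (vanishingIdeal ⟨closure F₁', isClosed_closure⟩) s₁' =
            Ideal.span {∏ i, (Fin.cons g ((φ'.stalkMap s₁').hom ∘ x) : Fin (n + 1) → _) i})) :
    (IsUnit g₀ →
      IsRsopPart ((φ.stalkMap (e₁ s₁')).hom ∘ x₀) ∧
        stalkIdeal (vanishingIdeal ⟨closure F₁, isClosed_closure⟩) (e₁ s₁') =
          Ideal.span {∏ i, (φ.stalkMap (e₁ s₁')).hom (x₀ i)}) ∧
    (¬ IsUnit g₀ →
      IsRsopPart (Fin.cons g₀ ((φ.stalkMap (e₁ s₁')).hom ∘ x₀) : Fin (n + 1) → _) ∧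
        stalkIdeal (vanishingIdeal ⟨closure F₁, isClosed_closure⟩) (e₁ s₁') =
          Ideal.span {∏ i, (Fin.cons g₀ ((φ.stalkMap (e₁ s₁')).hom ∘ x₀) :
            Fin (n + 1) → _) i}) := by
  subst hF₁'
  haveI : IsLocallyNoetherian P := LocallyOfFiniteType.isLocallyNoetherian e₁
  haveI : IsLocallyNoetherian S' := LocallyOfFiniteType.isLocallyNoetherian e
  have hpt : φ (e₁ s₁') = e (φ' s₁') := by
    rw [← Scheme.Hom.comp_apply, hsq, Scheme.Hom.comp_apply]
  -- notation
  set ι : S.presheaf.stalk (φ (e₁ s₁')) ⟶ S.presheaf.stalk (e (φ' s₁')) :=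
    (S.presheaf.stalkCongr (Inseparable.of_eq hpt)).hom with hιdef
  set g : P.presheaf.stalk s₁' := (e₁.stalkMap s₁').hom g₀ with hgdef
  set x : Fin n → S'.presheaf.stalk (φ' s₁') := (e.stalkMap (φ' s₁')).hom ∘ ι.hom ∘ x₀
    with hxdef
  change (IsUnit g → IsRsopPart ((φ'.stalkMap s₁').hom ∘ x) ∧ _) ∧
    (¬ IsUnit g → IsRsopPart (Fin.cons g ((φ'.stalkMap s₁').hom ∘ x) : Fin (n + 1) → _) ∧ _) at H
  -- the square of stalk maps: `e₁^* ∘ φ^* = φ'^* ∘ e^* ∘ ι`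
  have hsqst : φ.stalkMap (e₁ s₁') ≫ e₁.stalkMap s₁' =
      ι ≫ e.stalkMap (φ' s₁') ≫ φ'.stalkMap s₁' := by
    rw [← Scheme.Hom.stalkMap_comp, ← Scheme.Hom.stalkMap_comp,
      Scheme.Hom.stalkMap_congr_hom (e₁ ≫ φ) (φ' ≫ e) hsq s₁']
    rfl
  have key : ∀ a, (e₁.stalkMap s₁').hom ((φ.stalkMap (e₁ s₁')).hom a) =
      (φ'.stalkMap s₁').hom ((e.stalkMap (φ' s₁')).hom (ι.hom a)) := by
    intro a
    have := congrArg (fun f => f.hom a) hsqst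
    simpa only [CommRingCat.hom_comp, RingHom.comp_apply] using this
  have hunit : IsUnit g ↔ IsUnit g₀ := isUnit_map_iff (e₁.stalkMap s₁').hom g₀
  have hfam : (e₁.stalkMap s₁').hom ∘ ((φ.stalkMap (e₁ s₁')).hom ∘ x₀) =
      (φ'.stalkMap s₁').hom ∘ x := by
    funext i
    exact key (x₀ i)
  have hfam' : (e₁.stalkMap s₁').hom ∘ (Fin.cons g₀ ((φ.stalkMap (e₁ s₁')).hom ∘ x₀) :
      Fin (n + 1) → _) = (Fin.cons g ((φ'.stalkMap s₁').hom ∘ x) : Fin (n + 1) → _) := by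
    funext i
    refine Fin.cases ?_ (fun j => ?_) i
    · simp only [Function.comp_apply, Fin.cons_zero, hgdef]
    · simp only [Function.comp_apply, Fin.cons_succ]
      exact key (x₀ j)
  -- the étale local algebra `𝒪_{S₁, e₁ s₁'} → 𝒪_{P, s₁'}`
  letI := (e₁.stalkMap s₁').hom.toAlgebra
  haveI := flat_stalkAlgebra e₁ s₁'
  haveI := formallyUnramified_stalkAlgebra e₁ s₁'
  haveI := essFiniteType_stalkAlgebra e₁ s₁'
  haveI := isLocalHom_stalkAlgebra e₁ s₁'
  have halg : (algebraMap (S₁.presheaf.stalk (e₁ s₁')) (P.presheaf.stalk s₁') : _ →+* _) =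
      (e₁.stalkMap s₁').hom := rfl
  -- the ideal of `F₁` extends to the ideal of `e₁⁻¹ F₁`
  have hideal : (stalkIdeal (vanishingIdeal ⟨closure F₁, isClosed_closure⟩) (e₁ s₁')).map
      (algebraMap (S₁.presheaf.stalk (e₁ s₁')) (P.presheaf.stalk s₁')) =
        stalkIdeal (vanishingIdeal ⟨closure (e₁ ⁻¹' F₁), isClosed_closure⟩) s₁' := by
    rw [halg, ← stalkIdeal_comap_eq_map_stalkMap, comap_vanishingIdeal_of_etale]
    congr 2
    apply Closeds.ext
    simp only [Closeds.coe_preimage, Closeds.coe_mk, hF₁.closure_eq,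
      (hF₁.preimage e₁.continuous).closure_eq]
  constructor
  · intro hu
    obtain ⟨hr, hI⟩ := H.1 (hunit.mpr hu)
    have hr' : IsRsopPart (algebraMap (S₁.presheaf.stalk (e₁ s₁')) (P.presheaf.stalk s₁') ∘
        ((φ.stalkMap (e₁ s₁')).hom ∘ x₀)) := by
      rw [halg, hfam]
      exact hr
    refine IsRsopPart.of_etaleLocal_of_map_eq _ hr' _ ?_
    rw [hideal, hI, halg]
    congr 2
    exact Finset.prod_congr rfl fun i _ => (key (x₀ i)).symm
  · intro hu
    obtain ⟨hr, hI⟩ := H.2 (fun h => hu (hunit.mp h))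
    have hr' : IsRsopPart (algebraMap (S₁.presheaf.stalk (e₁ s₁')) (P.presheaf.stalk s₁') ∘
        (Fin.cons g₀ ((φ.stalkMap (e₁ s₁')).hom ∘ x₀) : Fin (n + 1) → _)) := by
      rw [halg, hfam']
      exact hr
    refine IsRsopPart.of_etaleLocal_of_map_eq _ hr' _ ?_
    rw [hideal, hI, halg]
    congr 2
    refine Finset.prod_congr rfl fun i _ => ?_
    exact (congrFun hfam' i).symm

end Pointwise

/-! ## The reduction -/

/-- A blowing up of a locally Noetherian scheme has locally Noetherian source (it is proper,
`IsBlowup.isProper`, in particular locally of finite type). [folklore] -/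
theorem isLocallyNoetherian_of_isBlowup {S₁ S : Scheme.{u}} [IsLocallyNoetherian S] {φ : S₁ ⟶ S}
    {I : S.IdealSheafData} (hφ : IsBlowup φ I) : IsLocallyNoetherian S₁ := by
  haveI : IsProper φ := hφ.isProper
  exact LocallyOfFiniteType.isLocallyNoetherian φ

/-- **de Jong 1996, 2.4, the blowing-up step for normal crossings divisors, from the strict
case.** `SNCBlowupTopStratum` implies `DeJong1996NormalCrossingsBlowupStep`: blow up `S`
in the reduced top stratum (`SncStrata.lean`: closed, `isClosed_topStratum`)
`C = topStratum S Z F m` and take `F₁ = φ⁻¹(F ∪ C)`; all claims are checked after the étale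
surjective base change `S₁ ×_S S' → S₁` along which `Z` becomes strict, where they are the
content of the named fact, and descend: normal crossings by definition, the bound by
invariance of branch orders, strictness of `F₁` by `IsRsopPart.of_etaleLocal_of_map_eq`.
[cite: DeJong1996, 2.4, p. 55] -/
theorem DeJong1996NormalCrossingsBlowupStep.of_sncBlowupTopStratum
    (h₂ : SNCBlowupTopStratum.{u}) : DeJong1996NormalCrossingsBlowupStep.{u} := by
  intro S _ Z F m hZ hF hFZ hb
  classical
  obtain ⟨S', e, he, hsurj, hZ'⟩ := hZ
  haveI := he
  haveI := hsurj
  haveI : IsLocallyNoetherian S' := LocallyOfFiniteType.isLocallyNoetherian e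
  have hZnc : IsNormalCrossingsDivisor S Z := ⟨S', e, he, hsurj, hZ'⟩
  have hZc : IsClosed Z := hZnc.isClosed
  have hFc : IsClosed F := hF.isClosed
  have hF' : IsStrictNormalCrossingsDivisor S' (e ⁻¹' F) := hF.preimage_of_etale e
  have hFZ' : e ⁻¹' F ⊆ e ⁻¹' Z := Set.preimage_mono hFZ
  have hb' : ∀ s' ∈ e ⁻¹' Z,
      branchOrder S' (e ⁻¹' Z) s' ≤ branchOrder S' (e ⁻¹' F) s' + (m + 1 : ℕ) := by
    intro s' hs'
    rw [branchOrder_preimage_of_etale e hZc, branchOrder_preimage_of_etale e hFc]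
    exact hb _ hs'
  -- the centres
  set C : Set S := topStratum S Z F m with hCdef
  set C' : Set S' := topStratum S' (e ⁻¹' Z) (e ⁻¹' F) m with hC'def
  have hCC' : e ⁻¹' C = C' := preimage_topStratum_of_etale e hZc hFc
  have hC'c : IsClosed C' := isClosed_topStratum hZ' hF' hFZ' hb'
  have hCc : IsClosed C :=
    isClosed_of_preimage_of_surjective_of_isOpenMap e.isOpenMap e.surjective (hCC' ▸ hC'c)
  have hCZ : C ⊆ Z := topStratum_subset m
  -- the blowing up of `S` in `I = I_C`
  set I : S.IdealSheafData := vanishingIdeal ⟨C, hCc⟩ with hIdef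
  have hIZ : (I.support : Set S) ⊆ Z := by
    rw [hIdef, coe_support_vanishingIdeal]
    exact hCZ
  obtain ⟨S₁, φ, hφ⟩ := exists_isBlowup S I
  haveI : IsLocallyNoetherian S₁ := isLocallyNoetherian_of_isBlowup hφ
  -- base change along `e`
  set φ' : pullback φ e ⟶ S' := pullback.snd φ e with hφ'def
  set e₁ : pullback φ e ⟶ S₁ := pullback.fst φ e with he₁def
  have hsq : e₁ ≫ φ = φ' ≫ e := pullback.condition
  have hcomm : ∀ s : ↥(pullback φ e), φ (e₁ s) = e (φ' s) := fun s => by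
    rw [← Scheme.Hom.comp_apply, hsq, Scheme.Hom.comp_apply]
  have hI' : I.comap e = vanishingIdeal ⟨C', hC'c⟩ := by
    rw [hIdef, comap_vanishingIdeal_of_etale]
    congr 1
    exact Closeds.ext hCC'
  have hφ' : IsBlowup φ' (vanishingIdeal ⟨C', hC'c⟩) := hI' ▸ hφ.pullback_snd_of_flat e
  obtain ⟨hZ₁', hb₁', hpt⟩ := h₂ S' _ _ m hZ' hF' hFZ' hb' hC'c _ φ' hφ'
  -- preimages
  have hpreZ : e₁ ⁻¹' (φ ⁻¹' Z) = φ' ⁻¹' (e ⁻¹' Z) := by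
    ext s; simp only [Set.mem_preimage, hcomm]
  have hpreF : e₁ ⁻¹' (φ ⁻¹' (F ∪ C)) = φ' ⁻¹' (e ⁻¹' F ∪ C') := by
    ext s; simp only [Set.mem_preimage, Set.mem_union, hcomm, ← hCC']
  have hZ₁c : IsClosed (φ ⁻¹' Z) := hZc.preimage φ.continuous
  have hF₁c : IsClosed (φ ⁻¹' (F ∪ C)) := (hFc.union hCc).preimage φ.continuous
  refine ⟨S₁, φ, I, φ ⁻¹' (F ∪ C), hφ, hIZ, ?_, ?_, ?_, ?_⟩
  · -- `φ⁻¹Z` is a normal crossings divisor: it becomes strict on `S₁ ×_S S'`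
    refine ⟨pullback φ e, e₁, inferInstance, inferInstance, ?_⟩
    rw [hpreZ]
    exact hZ₁'
  · -- `F₁ = φ⁻¹(F ∪ C)` is a STRICT normal crossings divisor: pointwise étale descent
    refine IsStrictNormalCrossingsDivisor.of_forall_isStrictNormalCrossingsAt hF₁c
      fun s₁ hs₁ => ?_
    obtain ⟨s₁', rfl⟩ := e₁.surjective s₁
    have hsZ : φ (e₁ s₁') ∈ Z := (Set.union_subset hFZ hCZ) hs₁
    -- a local equation `g₀` of the exceptional divisor `φ⁻¹C` at `e₁ s₁'`
    obtain ⟨g₀, hg₀⟩ : ∃ g₀ : S₁.presheaf.stalk (e₁ s₁'),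
        stalkIdeal (I.comap φ) (e₁ s₁') = Ideal.span {g₀} := by
      obtain ⟨U, hxU, f, -, hfU⟩ := hφ.isEffectiveCartier (e₁ s₁')
      refine ⟨(S₁.presheaf.germ U _ hxU).hom f, ?_⟩
      rw [stalkIdeal_eq_map_germ _ U hxU, hfU, Ideal.map_span, Set.image_singleton]
    -- `g₀` is a unit iff `φ (e₁ s₁') ∉ C`
    have hg₀C : IsUnit g₀ → φ (e₁ s₁') ∉ C := by
      intro hu hC
      have hmem : e₁ s₁' ∈ (I.comap φ).support := by
        rw [support_comap]
        change φ (e₁ s₁') ∈ (I.support : Set S)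
        rw [hIdef, coe_support_vanishingIdeal]
        exact hC
      rw [mem_support_iff_stalkIdeal_le, hg₀, Ideal.span_singleton_le_iff_mem] at hmem
      exact (IsLocalRing.mem_maximalIdeal _).mp hmem hu
    -- regular parameters `x₀` cutting out `F` at `φ (e₁ s₁')` (none if this point is off `F`)
    obtain ⟨n, x₀, hx₀, hIx₀, hn⟩ : ∃ (n : ℕ) (x₀ : Fin n → S.presheaf.stalk (φ (e₁ s₁'))),
        IsRsopPart x₀ ∧
          stalkIdeal (vanishingIdeal ⟨closure F, isClosed_closure⟩) (φ (e₁ s₁')) =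
            Ideal.span {∏ i, x₀ i} ∧ (φ (e₁ s₁') ∈ F → 1 ≤ n) := by
      by_cases hsF : φ (e₁ s₁') ∈ F
      · obtain ⟨r, x, hr, hx, hI⟩ :=
          (isSNCIdeal_iff_exists_isRsopPart _).mp (hF.isStrictNormalCrossingsAt hsF)
        exact ⟨r, x, hx, hI, fun _ => hr⟩
      · haveI := hZnc.isRegularLocalRing hsZ
        refine ⟨0, Fin.elim0, isRsopPart_of_isRegularLocalRing_zero _, ?_, fun h => (hsF h).elim⟩
        rw [Finset.univ_eq_empty, Finset.prod_empty, Ideal.span_singleton_one,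
          stalkIdeal_eq_top_of_not_mem_support]
        intro hmem
        apply hsF
        have hmem' : φ (e₁ s₁') ∈
            ((vanishingIdeal (⟨closure F, isClosed_closure⟩ : Closeds S)).support : Set S) := hmem
        rw [coe_support_vanishingIdeal] at hmem'
        change φ (e₁ s₁') ∈ closure F at hmem'
        rwa [hFc.closure_eq] at hmem'
    -- the data upstairs, at `s₁'`
    have hs₁' : s₁' ∈ φ' ⁻¹' (e ⁻¹' F ∪ C') := by
      rw [← hpreF]
      exact hs₁
    have hg : stalkIdeal ((vanishingIdeal ⟨C', hC'c⟩).comap φ') s₁' =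
        Ideal.span {(e₁.stalkMap s₁').hom g₀} := by
      rw [← hI', ← Scheme.IdealSheafData.comap_comp, ← hsq, Scheme.IdealSheafData.comap_comp,
        stalkIdeal_comap_eq_map_stalkMap, hg₀, Ideal.map_span, Set.image_singleton]
    set ι : S.presheaf.stalk (φ (e₁ s₁')) ⟶ S.presheaf.stalk (e (φ' s₁')) :=
      (S.presheaf.stalkCongr (Inseparable.of_eq (hcomm s₁'))).hom with hιdef
    set x : Fin n → S'.presheaf.stalk (φ' s₁') := (e.stalkMap (φ' s₁')).hom ∘ ι.hom ∘ x₀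
      with hxdef
    have hx : IsRsopPart x ∧
        stalkIdeal (vanishingIdeal ⟨closure (e ⁻¹' F), isClosed_closure⟩) (φ' s₁') =
          Ideal.span {∏ i, x i} := by
      letI := (e.stalkMap (φ' s₁')).hom.toAlgebra
      haveI := flat_stalkAlgebra e (φ' s₁')
      haveI := formallyUnramified_stalkAlgebra e (φ' s₁')
      haveI := essFiniteType_stalkAlgebra e (φ' s₁')
      haveI := isLocalHom_stalkAlgebra e (φ' s₁')
      have hι : IsRsopPart (ι.hom ∘ x₀) := hx₀.comp_stalkCongr (hcomm s₁')
      constructor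
      · exact (isRsopPart_map_iff_of_etaleLocal (A := S.presheaf.stalk (e (φ' s₁')))
          (B := S'.presheaf.stalk (φ' s₁')) (ι.hom ∘ x₀)).mpr hι
      · have h1 : (⟨closure (e ⁻¹' F), isClosed_closure⟩ : Closeds S') =
            (⟨closure F, isClosed_closure⟩ : Closeds S).preimage e.continuous := by
          apply Closeds.ext
          simp only [Closeds.coe_mk, Closeds.coe_preimage, hFc.closure_eq,
            (hFc.preimage e.continuous).closure_eq]
        rw [h1, ← comap_vanishingIdeal_of_etale, stalkIdeal_comap_eq_map_stalkMap,
          ← map_stalkCongr_stalkIdeal _ (hcomm s₁'), hIx₀, Ideal.map_span, Set.image_singleton,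
          map_prod, Ideal.map_span, Set.image_singleton, map_prod]
        rfl
    have H := hpt s₁' hs₁' _ hg n x hx.1 hx.2
    have D := isRsopPart_and_stalkIdeal_eq_of_etale_square φ e e₁ φ' hsq hF₁c hpreF s₁' g₀ x₀ H
    -- conclusion
    change IsSNCIdeal _
    rw [isSNCIdeal_iff_exists_isRsopPart]
    by_cases hu : IsUnit g₀
    · obtain ⟨hr, hI⟩ := D.1 hu
      have hsF : φ (e₁ s₁') ∈ F := by
        rcases hs₁ with h | h
        · exact h
        · exact (hg₀C hu h).elim
      exact ⟨n, _, hn hsF, hr, hI⟩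
    · obtain ⟨hr, hI⟩ := D.2 hu
      exact ⟨n + 1, _, Nat.succ_pos n, hr, hI⟩
  · exact Set.preimage_mono (Set.union_subset hFZ hCZ)
  · -- the bound `m` descends
    intro s₁ hs₁
    obtain ⟨s₁', rfl⟩ := e₁.surjective s₁
    rw [← branchOrder_preimage_of_etale e₁ hZ₁c, ← branchOrder_preimage_of_etale e₁ hF₁c, hpreZ,
      hpreF]
    exact hb₁' _ (by rw [← hpreZ]; exact hs₁)

end Literature.AlgebraicGeometry.Resolution

end
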